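import Summits.HodgeConjecture.CorCM.HodgeLieLefschetzCodimension
import Summits.HodgeConjecture.CorCM.MumfordTateRankSevenQuaternionConverse
import Literature.AlgebraicGeometry.HodgeTheory.NoTypeIVTimesCMStablyNondegenerate
import Literature.Algebra.Lie.SymplecticAlgebraDimension
import Literature.Algebra.Lie.SemisimpleDimensionEight
import HarnessLib

/-!
# The symplectic bound `dim Lie Hg(H¹X) ≤ g(2g+1)` for every abelian variety, and `End⁰X = ℚ`: the rank just below the top is
# never attained (`dim MT(H¹X) ≠ g(2g+1)`); surfaces with `End⁰ = ℚ` have `dim MT(H¹X) ∈ {7, 11}`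

COR-CM (cell `pub-hodgecm2`, seat `b27` gen 45, count-neutral Mumford–Tate-rank ladder; theorems only, no definition, no named
fact; UNCONDITIONAL — nothing here uses or asserts HC_CM).

* **`finrank_hodgeLie_hodge_one_le_symplectic`**, **`mtRank_hodge_one_le_symplectic`** — for EVERY complex abelian variety `X` of
  dimension `g`: `Lie Hg(H¹X) ⊆ 𝔰𝔭(H¹X, ψ)`, so `dim Lie Hg(H¹X) ≤ g(2g+1)` and `dim MT(H¹X) ≤ g(2g+1) + 1` (`dim 𝔰𝔭_{2g} = g(2g+1)`,
  `Literature/Algebra/Lie/SymplecticAlgebraDimension`; Deligne: `Hg ⊆ Sp(H¹, ψ)`).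
* **`lefschetz_eq_skewAdjoint_of_finrank_endAlgebra_eq_one`** — if `End⁰X = ℚ` then the Lefschetz Lie algebra
  `C(End_Hdg) ∩ 𝔰𝔭(ψ)` is all of `𝔰𝔭(H¹X, ψ)`.
* **`mtRank_hodge_one_ne_of_finrank_endAlgebra_eq_one`** — `End⁰X = ℚ` ⟹ **`dim MT(H¹X) ≠ g(2g+1)`**: the Hodge Lie algebra is
  `𝔰𝔭_{2g}` or has codimension `≥ 2` in it (`CorCM/HodgeLieLefschetzCodimension`: a perfect Killing subalgebra of codimension one
  with trivial centraliser would be everything).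
* **`mtRank_hodge_one_eq_seven_or_eleven_of_surface_of_finrank_endAlgebra_eq_one`** — an abelian SURFACE with `End⁰X = ℚ` has
  `dim MT(H¹X) ∈ {7, 11}`: `t ≤ 11`; `t ≥ 4`, `t ≠ 4` (`dim End⁰ ≠ 4`), `t ∉ {5, 6, 8}` (no type IV) by the lower rungs; `t ≠ 10` by
  codimension one; `t ≠ 9` since an `8`-dimensional semisimple Lie algebra is SIMPLE (`SemisimpleDimensionEight`) and `2² < 8`.
  (In print `Hg = Sp₄`, `t = 11`; the value `7` is the type-III position `(1,1,4)`, excluded by `8 ∣ dim_ℚ H¹` — the lane's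
  `HodgeLieWeightOnePlusLineParity`, not yet in the tree.)

## References
* [Deligne1982HodgeCycles] P. Deligne, *Hodge cycles on abelian varieties*, LNM 900 (1982), I §3 (`Hg ⊆ Sp`), Prop. 3.6.
* [MoonenZarhin1999LowDim] B. Moonen, Yu. Zarhin, Math. Ann. 315 (1999), §1, §2 (2.1) (`End⁰X = ℚ`: `Hg = Sp` or Mumford type).
* [Humphreys1972] J. E. Humphreys, GTM 9 (1972), §1.2 (`dim C_l = 2l² + l`), §5.2, §5.3.
-/

noncomputable section

open scoped TensorProduct
open CategoryTheory CategoryTheory.Limits Module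

namespace Summit.HodgeConjecture.CorCM

open Literature.AlgebraicGeometry.Motives
open Literature.AlgebraicGeometry.Motives.AbelianVariety
open Literature.AlgebraicGeometry.Motives.HodgeStructure
open Literature.AlgebraicGeometry.HodgeTheory
open Literature.AlgebraicGeometry.Milne1999 (IsOfCMType)
open Literature.Algebra.Lie

variable [HodgeTensorFacts.{0, 0}] {X : AbelianVariety ℂ} {n : ℕ}

/-! ## §1 The symplectic bound -/

/-- **`dim Lie Hg(H¹X) ≤ g(2g+1)` for every complex abelian variety of dimension `g`**: `Lie Hg(H¹X)` consists of `ψ`-skew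
endomorphisms (`Hg ⊆ Sp(H¹X, ψ)`) and `dim 𝔰𝔭_{2g} = g(2g+1)`. [cite: Deligne1982HodgeCycles, I §3 Prop. 3.6]
[cite: Humphreys1972, §1.2] -/
theorem finrank_hodgeLie_hodge_one_le_symplectic (hX : IsSmoothProjective n X.X) :
    haveI := BettiUniverse.finite hX 1
    Module.finrank ℚ (BettiUniverse.hodge exists_isReal_hodgeModel_holds hX 1).hodgeLie ≤ X.dim * (2 * X.dim + 1) := by
  classical
  haveI := BettiUniverse.finite hX 1
  obtain ⟨ψ⟩ := BettiUniverse.hodge_isPolarizable exists_isReal_hodgeModel_holds hX 1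
  have hle : (BettiUniverse.hodge exists_isReal_hodgeModel_holds hX 1).hodgeLie ≤ ψ.form.skewAdjointSubmodule := by
    intro Y hY
    rw [LinearMap.mem_skewAdjointSubmodule]
    intro v w
    rw [Pi.neg_apply, map_neg, ← add_eq_zero_iff_eq_neg]
    exact form_apply_add_eq_zero_of_mem_hodgeLie ψ hY v w
  have hflip : ψ.form.flip = -ψ.form := by
    rw [ψ.flip_form, show (((1 : ℕ) : ℤ).negOnePow : ℤˣ) = -1 from Int.negOnePow_one, Units.val_neg, Units.val_one,
      neg_one_zsmul]
  have hs := SymplecticDimension.two_mul_finrank_skewAdjointSubmodule_of_flip_eq_neg ψ.form ψ.nondegenerate hflip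
  rw [finrank_bettiCohomology_one_eq_two_mul_dim X] at hs
  have h := Submodule.finrank_mono hle
  have hs' : Module.finrank ℚ ψ.form.skewAdjointSubmodule = X.dim * (2 * X.dim + 1) := by nlinarith [hs]
  omega

/-- **`dim MT(H¹X) ≤ g(2g+1) + 1`** for every complex abelian variety of dimension `g > 0` (`dim MT = dim Lie Hg + 1`).
[cite: Deligne1982HodgeCycles, I §3 Prop. 3.6] [cite: Humphreys1972, §1.2] -/
theorem mtRank_hodge_one_le_symplectic (hX : IsSmoothProjective n X.X) (h0 : 0 < X.dim) :
    haveI := BettiUniverse.finite hX 1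
    (BettiUniverse.hodge exists_isReal_hodgeModel_holds hX 1).mtRank ≤ X.dim * (2 * X.dim + 1) + 1 := by
  haveI := BettiUniverse.finite hX 1
  have h := finrank_hodgeLie_hodge_one_le_symplectic hX
  rw [mtRank_hodge_one_eq_finrank_hodgeLie_add_one hX h0]
  omega

/-! ## §2 `End⁰X = ℚ`: the Lefschetz Lie algebra is `𝔰𝔭`, and the rank `g(2g+1)` is skipped -/

omit [HodgeTensorFacts.{0, 0}] in
/-- **`End⁰X = ℚ` ⟹ `C(End_Hdg H¹X) ∩ 𝔰𝔭(ψ) = 𝔰𝔭(H¹X, ψ)`**: every Hodge endomorphism is a rational scalar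
(`dim_ℚ End_Hdg(H¹X) = dim_ℚ End⁰X = 1`). [cite: MoonenZarhin1999LowDim, §2 (2.1)] -/
theorem lefschetz_eq_skewAdjoint_of_finrank_endAlgebra_eq_one (hX : IsSmoothProjective n X.X)
    (h1 : Module.finrank ℚ X.endAlgebra = 1) [Module.Finite ℚ (bettiCohomology X.X 1)]
    (ψ : (BettiUniverse.hodge exists_isReal_hodgeModel_holds hX 1).Polarization) :
    Subalgebra.toSubmodule (Subalgebra.centralizer ℚ
          ((BettiUniverse.hodge exists_isReal_hodgeModel_holds hX 1).endAlg : Set (Module.End ℚ (bettiCohomology X.X 1)))) ⊓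
        ψ.form.skewAdjointSubmodule = ψ.form.skewAdjointSubmodule := by
  refine inf_eq_right.2 fun Y _ => ?_
  rw [Subalgebra.mem_toSubmodule, Subalgebra.mem_centralizer_iff]
  intro g hg
  -- `g` is a rational scalar
  have hE1 : Module.finrank ℚ (BettiUniverse.hodge exists_isReal_hodgeModel_holds hX 1).endAlg = 1 := by
    rw [← finrank_endAlgebra_eq_finrank_endAlg hX]; exact h1
  haveI : Nontrivial (BettiUniverse.hodge exists_isReal_hodgeModel_holds hX 1).endAlg :=
    Module.nontrivial_of_finrank_pos (R := ℚ) (by rw [hE1]; norm_num)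
  have hne : (1 : (BettiUniverse.hodge exists_isReal_hodgeModel_holds hX 1).endAlg) ≠ 0 := one_ne_zero
  obtain ⟨q, hq⟩ := (finrank_eq_one_iff_of_nonzero' _ hne).1 hE1 ⟨g, hg⟩
  have hgq : g = q • (1 : Module.End ℚ (bettiCohomology X.X 1)) := by
    have h' := congrArg Subtype.val hq
    exact h'.symm
  rw [hgq, smul_mul_assoc, mul_smul_comm, one_mul, mul_one]

/-- **`End⁰X = ℚ` ⟹ `dim MT(H¹X) ≠ g(2g+1)`** (`g = dim X > 0`): with `End_Hdg = ℚ` the Lefschetz Lie algebra is `𝔰𝔭(H¹X, ψ)` of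
dimension `g(2g+1)`, and the Hodge Lie algebra (perfect, Killing, trivial centraliser — no type IV) cannot have codimension one in
it (`CorCM/HodgeLieLefschetzCodimension`).  So `dim MT ≤ g(2g+1) + 1` with the value `g(2g+1)` skipped.
[cite: MoonenZarhin1999LowDim, §1 and §2 (2.1)] [cite: Humphreys1972, §5.3 Theorem] -/
theorem mtRank_hodge_one_ne_of_finrank_endAlgebra_eq_one (hX : IsSmoothProjective n X.X) (h0 : 0 < X.dim)
    (h1 : Module.finrank ℚ X.endAlgebra = 1) :
    haveI := BettiUniverse.finite hX 1
    (BettiUniverse.hodge exists_isReal_hodgeModel_holds hX 1).mtRank ≠ X.dim * (2 * X.dim + 1) := by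
  classical
  haveI := BettiUniverse.finite hX 1
  intro ht
  obtain ⟨ψ⟩ := BettiUniverse.hodge_isPolarizable exists_isReal_hodgeModel_holds hX 1
  have hA4 : HasNoTypeIVFactor X := hasNoTypeIVFactor_of_finrank_endAlgebra_eq_one h1
  have hne := finrank_lefschetz_ne_finrank_hodgeLie_add_one hX hA4 ψ
  rw [lefschetz_eq_skewAdjoint_of_finrank_endAlgebra_eq_one hX h1 ψ] at hne
  have hflip : ψ.form.flip = -ψ.form := by
    rw [ψ.flip_form, show (((1 : ℕ) : ℤ).negOnePow : ℤˣ) = -1 from Int.negOnePow_one, Units.val_neg, Units.val_one,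
      neg_one_zsmul]
  have hs := SymplecticDimension.two_mul_finrank_skewAdjointSubmodule_of_flip_eq_neg ψ.form ψ.nondegenerate hflip
  rw [finrank_bettiCohomology_one_eq_two_mul_dim X] at hs
  have hs' : Module.finrank ℚ ψ.form.skewAdjointSubmodule = X.dim * (2 * X.dim + 1) := by nlinarith [hs]
  have hmt := mtRank_hodge_one_eq_finrank_hodgeLie_add_one hX h0
  rw [ht] at hmt
  apply hne
  rw [hs']
  omega

/-! ## §3 Surfaces with `End⁰X = ℚ` -/

/-- **An abelian SURFACE with `End⁰X = ℚ` has `dim MT(H¹X) ∈ {7, 11}`**: `t ≤ 11` (§1); `t ≥ 4` (not CM) and `t ≠ 4`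
(`dim_ℚ End⁰X = 1 ≠ 4`); `t ∉ {5, 6, 8}` (no factor of type IV); `t ≠ 10` (§2); `t ≠ 9`: then `Lie Hg` would be an `8`-dimensional
semisimple, hence SIMPLE, Lie algebra of codimension `2` in `𝔰𝔭₄` with `2² < 8`, so equal to `𝔰𝔭₄`
(`hodgeLie_hodge_one_eq_lefschetz_of_isSimple_of_sq_lt`).  (In print `Hg = Sp₄`, `t = 11`: the value `7` is the type-III grading
`(1, 1, 4)`, excluded by `8 ∣ dim_ℚ H¹X`.) [cite: MoonenZarhin1999LowDim, §1 and §2 (2.1)] [cite: Humphreys1972, §5.2 and §5.3] -/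
theorem mtRank_hodge_one_eq_seven_or_eleven_of_surface_of_finrank_endAlgebra_eq_one (hX : IsSmoothProjective n X.X)
    (hX2 : X.dim = 2) (h1 : Module.finrank ℚ X.endAlgebra = 1) :
    haveI := BettiUniverse.finite hX 1
    (BettiUniverse.hodge exists_isReal_hodgeModel_holds hX 1).mtRank = 7 ∨
      (BettiUniverse.hodge exists_isReal_hodgeModel_holds hX 1).mtRank = 11 := by
  classical
  haveI := BettiUniverse.finite hX 1
  letI : LieRing (Module.End ℚ (bettiCohomology X.X 1)) := LieRing.ofAssociativeRing
  have h0 : 0 < X.dim := by omega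
  have hA4 : HasNoTypeIVFactor X := hasNoTypeIVFactor_of_finrank_endAlgebra_eq_one h1
  have hz := hodgeLie_hodge_one_inf_endAlg_eq_bot_of_hasNoTypeIVFactor hX hA4
  have hcm : ¬ IsOfCMType X := not_isOfCMType_of_hasNoTypeIVFactor hX h0 hA4
  have h11 := mtRank_hodge_one_le_symplectic hX h0
  rw [hX2] at h11
  have h10 := mtRank_hodge_one_ne_of_finrank_endAlgebra_eq_one hX h0 h1
  rw [hX2] at h10
  obtain ⟨-, -, h5, h6, h8⟩ := mtRank_hodge_one_ne_of_hasNoTypeIVFactor hX h0 hA4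
  have h4 := four_le_mtRank_hodge_one_of_not_isOfCMType hX hcm
  have hne4 : (BettiUniverse.hodge exists_isReal_hodgeModel_holds hX 1).mtRank ≠ 4 := by
    intro h
    obtain ⟨hsq, -, -⟩ := finrank_endAlgebra_eq_dim_sq_of_not_isOfCMType hX h0 hcm h.le
    rw [h1, hX2] at hsq
    norm_num at hsq
  -- `t ≠ 9`: a simple `8`-dimensional Hodge Lie algebra of codimension `2` in `𝔰𝔭₄` would be all of it
  have hne9 : (BettiUniverse.hodge exists_isReal_hodgeModel_holds hX 1).mtRank ≠ 9 := by
    intro h9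
    obtain ⟨ψ⟩ := BettiUniverse.hodge_isPolarizable exists_isReal_hodgeModel_holds hX 1
    have ht := mtRank_hodge_one_eq_finrank_hodgeLie_add_one hX h0
    have h8' : Module.finrank ℚ (BettiUniverse.hodge exists_isReal_hodgeModel_holds hX 1).hodgeLie = 8 := by
      change (BettiUniverse.hodge exists_isReal_hodgeModel_holds hX 1).mtRank =
        Module.finrank ℚ (BettiUniverse.hodge exists_isReal_hodgeModel_holds hX 1).hodgeLie + 1 at ht
      change (BettiUniverse.hodge exists_isReal_hodgeModel_holds hX 1).mtRank = 9 at h9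
      omega
    have hflip : ψ.form.flip = -ψ.form := by
      rw [ψ.flip_form, show (((1 : ℕ) : ℤ).negOnePow : ℤˣ) = -1 from Int.negOnePow_one, Units.val_neg, Units.val_one,
        neg_one_zsmul]
    have hs := SymplecticDimension.two_mul_finrank_skewAdjointSubmodule_of_flip_eq_neg ψ.form ψ.nondegenerate hflip
    rw [finrank_bettiCohomology_one_eq_two_mul_dim X, hX2] at hs
    have hs' : Module.finrank ℚ ψ.form.skewAdjointSubmodule = 10 := by omega
    have hlef := lefschetz_eq_skewAdjoint_of_finrank_endAlgebra_eq_one hX h1 ψ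
    -- `Lie Hg` is simple: semisimple of dimension `8`
    have hsimple : ∀ 𝔏 : LieSubalgebra ℚ (Module.End ℚ (bettiCohomology X.X 1)),
        𝔏.toSubmodule = (BettiUniverse.hodge exists_isReal_hodgeModel_holds hX 1).hodgeLie → LieAlgebra.IsSimple ℚ 𝔏 := by
      intro 𝔏 h𝔏
      haveI : Module.Finite ℚ 𝔏 := Module.Finite.of_injective 𝔏.toSubmodule.subtype Subtype.val_injective
      have hspan := hodgeLie_hodge_one_derived_eq_of_hasNoTypeIVFactor hX hA4
      haveI : LieAlgebra.IsSemisimple ℚ 𝔏 := (isSemisimple_of_eq_hodgeLie_hodge_one_derived hX 𝔏 (by rw [h𝔏, hspan])).1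
      have hdim : Module.finrank ℚ 𝔏 = 8 := by rw [← h8', ← h𝔏]; rfl
      exact SemisimpleSmallDimension.isSimple_of_finrank_eq_eight hdim
    have heq := hodgeLie_hodge_one_eq_lefschetz_of_isSimple_of_sq_lt hX hA4 ψ hsimple (by rw [hlef, hs', h8']; norm_num)
    rw [hlef] at heq
    have hfin : Module.finrank ℚ (BettiUniverse.hodge exists_isReal_hodgeModel_holds hX 1).hodgeLie =
        Module.finrank ℚ ψ.form.skewAdjointSubmodule := by rw [heq]
    omega
  omega

end Summit.HodgeConjecture.CorCM

end
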